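import Literature.AnabelianGeometry.AbsoluteAnabelian.MonoidKummerGaloisCyclotome

/-!
# The model Kummer theory of [AbsTopIII] Prop 3.2 with the GROUP-THEORETIC cyclotome `μ_Ẑ(G_k)` in the
# slot `μ_Ẑ(G)` (Rmk 3.2.1 as the structure field `cycIso`)

S. Mochizuki, *Topics in absolute anabelian geometry III*, §3, Rmk. 3.2.1 p. 73 ("a functorial algorithm for
constructing the natural isomorphism `μ_Ẑ(M_TM) ⥲ μ_Ẑ(G)`", `μ_Ẑ(G)` = the cyclotome of Cor. 1.10 (i)(a)
constructed from `G` alone) and Prop. 3.2 (ii) p. 71–72 (bib key `MochizukiAbsTopIII2015`; kurims pages,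
lit key `paper:url-5493eb38cbb7`).

abc-iut-L4-t2's structure `MonoidKummerTheory P` (`MonoidKummerMaps.lean`) carries the slot `muG` ("the
cyclotome `μ_Ẑ(G)` associated to `G` (Cor 1.10 (a))") and `cycIso : μ_Ẑ(M) ⥲ muG`; the model instance
`ModelMLFGaloisData.kummerTheory` (`MonoidKummerModel.lean`) fills `muG` with the FIELD-theoretic
`Ẑ(1) = Λ(k̄ˣ)` ("the group-theoretic cyclotome of Cor. 1.10 (a) is not yet in the tree" — it now is:
abc-iut-L4-t1's `muZhat G_k`, identified with `Ẑ(1)` by `TorsionReciprocityData.muZhatEquiv`, p420801).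
This file REFILLS the slot honestly:

* `ModelMLFGaloisData.cycIsoMuZhat R : μ_Ẑ(𝒪_k̄^⊳) ⥲ μ_Ẑ(G_k)` — Rmk. 3.2.1 with the group-theoretic target
  (units anchor `cyclotomeUnitsEquiv`, then `Λ(k̄ˣ ≃ k^algˣ)`, then `muZhatEquiv⁻¹`), and
  `map_rootsHom_cycIsoMuZhat` : read back in `k̄` through `Λ(rootsHom)` it is the units anchor;
* **`ModelMLFGaloisData.kummerTheoryMuZhat R : MonoidKummerTheory (Π_k ↷ 𝒪_k̄^⊳)`** — the model Kummer
  theory with `muG := μ_Ẑ(G_k)`, `cycIso := cycIsoMuZhat R`, all other fields those of `kummerTheory`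
  (`kummerTheoryMuZhat_kummer`, `_recoversClosure`), and its transport to every abstract MLF-Galois
  `TM`-pair, `GaloisMonoidPair.ModelPresentation.kummerTheoryMuZhat` (`muG` unchanged by transport).

With `MonoidKummerGaloisCyclotome.lean` (`kummerMuZhat`, `coeffIso`) this leaves ONE field of the model
theory that is not a real object: the `H²`-slot (`Ẑ` with `h2Iso := id`; Prop. 3.2 (i) = Cor. 1.10 (i)(a),
F-1387).  HONEST FRAMING: local class field theory as proved in the tree; nothing here bears on
[IUTchIII] Cor. 3.12; no side taken.
-/

noncomputable section

namespace Literature.AnabelianGeometry.AbsoluteAnabelian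

open Literature.AnabelianGeometry.EtaleTheta (kummerClass invariants cyclotomeRep)

section Model

variable (C : MLFClosure.{0}) (D : ModelMLFGaloisData C.k C.K) (R : TorsionReciprocityData C.k)

namespace MLFClosure

/-- `Λ(k̄ˣ) ⥲ Λ(k^algˣ)` along `k̄ ≃ k^alg`. [cite: MochizukiAbsTopIII2015, Definition 3.1 (i) p.66] -/
def cyclotomeUnitsToAlgClosure :
    EtaleTheta.cyclotome (C.K)ˣ ≃* EtaleTheta.cyclotome (AlgebraicClosure C.k)ˣ :=
  MulEquiv.ofBijective
    (EtaleTheta.cyclotome.map (Units.map (C.toAlgClosure : C.K →* AlgebraicClosure C.k)))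
    (EtaleTheta.cyclotome.map_bijective_of_bijective _
      (Units.mapEquiv (C.toAlgClosure : C.K ≃* AlgebraicClosure C.k)).bijective)

/-- Components of `cyclotomeUnitsToAlgClosure`. [cite: MochizukiAbsTopIII2015, Definition 3.1 (i) p.66] -/
@[simp] theorem coe_cyclotomeUnitsToAlgClosure_apply (ζ : EtaleTheta.cyclotome (C.K)ˣ) (n : ℕ+) :
    (((C.cyclotomeUnitsToAlgClosure ζ : EtaleTheta.cyclotome (AlgebraicClosure C.k)ˣ) :
        ℕ+ → (AlgebraicClosure C.k)ˣ) n : AlgebraicClosure C.k) =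
      C.toAlgClosure (((ζ : ℕ+ → (C.K)ˣ) n : (C.K)ˣ) : C.K) := rfl

end MLFClosure

namespace ModelMLFGaloisData

/-- **Rmk. 3.2.1 with the group-theoretic target**: `μ_Ẑ(𝒪_k̄^⊳) = Λ((𝒪_k̄^⊳)ˣ) ⥲ Λ(k̄ˣ) ⥲ Λ(k^algˣ) ⥲ μ_Ẑ(G_k)`
(units anchor, change of algebraic closure, inverse reciprocity identification of `R`).
[cite: MochizukiAbsTopIII2015, Remark 3.2.1 p.73] -/
def cycIsoMuZhat : cyclotome (nonzeroIntegers C.k C.K) ≃* muZhat (Field.absoluteGaloisGroup C.k) :=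
  C.cyclotomeUnitsEquiv.trans (C.cyclotomeUnitsToAlgClosure.trans R.muZhatEquiv.symm)

/-- Consistency with the `μ_Ẑ(G)`-coefficient junction: read back in `k̄ˣ` through `Λ(rootsHom R)` (the map
underlying `coeffIso`), `cycIsoMuZhat R` is the units anchor `Λ((𝒪_k̄^⊳)ˣ) ⥲ Λ(k̄ˣ)`.
[cite: MochizukiAbsTopIII2015, Remark 3.2.1 p.73] -/
theorem map_rootsHom_cycIsoMuZhat (ζ : cyclotome (nonzeroIntegers C.k C.K)) :
    EtaleTheta.cyclotome.map (rootsHom C R) (cycIsoMuZhat C R ζ) = C.cyclotomeUnitsEquiv ζ := by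
  rw [map_rootsHom_eq, cycIsoMuZhat, MulEquiv.trans_apply, MulEquiv.trans_apply, MulEquiv.apply_symm_apply]
  refine Subtype.ext (funext fun n => Units.ext ?_)
  change C.toAlgClosure.symm (C.toAlgClosure _) = _
  rw [AlgEquiv.symm_apply_apply]

/-- **The model Kummer theory with `muG := μ_Ẑ(G_k)`** (group-theoretic cyclotome of Cor. 1.10 (i)(a)) and
`cycIso :=` Rmk. 3.2.1; cohomology, Kummer maps, field and additive structure as in `kummerTheory`.
[cite: MochizukiAbsTopIII2015, Proposition 3.2 (ii) p.71] -/
def kummerTheoryMuZhat : MonoidKummerTheory D.tmPair :=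
  { D.kummerTheory C with
    muG := muZhat (Field.absoluteGaloisGroup C.k)
    grpMuG := inferInstance
    cycIso := cycIsoMuZhat C R }

/-- The Kummer maps are those of `kummerTheory` (definitional). [cite: MochizukiAbsTopIII2015, Proposition 3.2 (ii) p.71] -/
theorem kummerTheoryMuZhat_kummer (H : OpenSubgroup D.tmPair.Pi)
    (m : {m : D.tmPair.M // ∀ h : H, (h : D.tmPair.Pi) • m = m}) :
    (kummerTheoryMuZhat C D R).kummer H m = (D.kummerTheory C).kummer H m := rfl

/-- `muG` is the group-theoretic `μ_Ẑ(G_k)` (definitional). [cite: MochizukiAbsTopIII2015, Remark 3.2.1 p.73] -/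
theorem kummerTheoryMuZhat_muG :
    (kummerTheoryMuZhat C D R).muG = muZhat (Field.absoluteGaloisGroup C.k) := rfl

/-- `cycIso` is Rmk. 3.2.1 with the group-theoretic target (definitional). [cite: MochizukiAbsTopIII2015, Remark 3.2.1 p.73] -/
theorem kummerTheoryMuZhat_cycIso : (kummerTheoryMuZhat C D R).cycIso = cycIsoMuZhat C R := rfl

/-- Prop. 3.2 (v), objects: the field of (iii) still recovers `k̄` (same `F`, `addStr`).
[cite: MochizukiAbsTopIII2015, Proposition 3.2 (v) p.72] -/
theorem kummerTheoryMuZhat_recoversClosure :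
    (kummerTheoryMuZhat C D R).RecoversClosure C (fun m : D.tmPair.M => (m : C.K)) :=
  D.kummerTheory_recoversClosure C

end ModelMLFGaloisData

end Model

/-! ### Abstract pairs -/

namespace GaloisMonoidPair.ModelPresentation

variable {P : GaloisMonoidPair.{0}} (π : P.ModelPresentation) (R : TorsionReciprocityData π.C.k)

/-- **The Kummer theory of an abstract MLF-Galois `TM`-pair with `muG := μ_Ẑ(G_k)`**: transport of
`kummerTheoryMuZhat` along the presentation (`MonoidKummerTheory.transport` keeps `muG` and composes `cycIso`
with `Λ(e_M⁻¹)`). [cite: MochizukiAbsTopIII2015, Proposition 3.2 (ii) p.71] -/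
def kummerTheoryMuZhat : MonoidKummerTheory P :=
  (π.D.kummerTheoryMuZhat π.C R).transport π.iso

/-- Its `muG` is `μ_Ẑ(G_k)` (definitional). [cite: MochizukiAbsTopIII2015, Remark 3.2.1 p.73] -/
theorem kummerTheoryMuZhat_muG : (π.kummerTheoryMuZhat R).muG = muZhat (Field.absoluteGaloisGroup π.C.k) := rfl

/-- Its Kummer maps are those of `π.kummerTheory` (definitional). [cite: MochizukiAbsTopIII2015, Proposition 3.2 (ii) p.71] -/
theorem kummerTheoryMuZhat_kummer (H : OpenSubgroup P.Pi) (m : {m : P.M // ∀ h : H, (h : P.Pi) • m = m}) :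
    (π.kummerTheoryMuZhat R).kummer H m = π.kummerTheory.kummer H m := rfl

/-- It recovers the closure (Prop. 3.2 (v), objects). [cite: MochizukiAbsTopIII2015, Proposition 3.2 (v) p.72] -/
theorem kummerTheoryMuZhat_recoversClosure :
    (π.kummerTheoryMuZhat R).RecoversClosure π.C (fun m => ((π.iso.isoM.symm m : π.D.tmPair.M) : π.C.K)) :=
  (π.D.kummerTheoryMuZhat_recoversClosure π.C R).transport π.iso

end GaloisMonoidPair.ModelPresentation

/-- **Existence, unconditionally**: every MLF-Galois `TM`-pair carries a Kummer theory recovering the closure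
whose `μ_Ẑ(G)`-slot is the GROUP-THEORETIC cyclotome `μ_Ẑ(G_k)` of a model presentation
(`nonempty_torsionReciprocityData`). [cite: MochizukiAbsTopIII2015, Proposition 3.2 (ii) p.71] -/
theorem exists_monoidKummerTheory_muG_eq_muZhat (P : GaloisMonoidPair.{0}) (hP : IsMLFGaloisMonoidPair .TM P) :
    ∃ (π : P.ModelPresentation) (T : MonoidKummerTheory P),
      T.muG = muZhat (Field.absoluteGaloisGroup π.C.k) ∧
        T.RecoversClosure π.C (fun m => ((π.iso.isoM.symm m : π.D.tmPair.M) : π.C.K)) := by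
  obtain ⟨π⟩ := GaloisMonoidPair.ModelPresentation.nonempty_iff.mpr hP
  obtain ⟨R⟩ := nonempty_torsionReciprocityData π.C.k
  exact ⟨π, π.kummerTheoryMuZhat R, rfl, π.kummerTheoryMuZhat_recoversClosure R⟩

end Literature.AnabelianGeometry.AbsoluteAnabelian

end
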